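import Summits.ResolutionOfSingularities.ResolutionOfSingularities.Theorems.EquisingularLiftEquisingularLiftNatConormalFrameOfQuasiRegular
import Literature.AlgebraicGeometry.HodgeTheory.BlochSemiregularityMapReal
import HarnessLib

/-!
# [OURS · L1 W4.5(b) · EL♮(3) · J1c brick B5 = (ν1)] Dual-frame coordinates of sections of the normal sheaf
Crux chain w45b, child EL♮(3) = stmt-ResolutionOfSingularities-20148; J1c = the tree-proof programme for the NEED-FACT
`EmbeddedInfinitesimalLiftFact` (res-type-027 `Lines/J1c-DESIGN-v2`, desk g19 RULING R3′ (ii) / R5 (i); signatures dealt in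
`L/res-type-027/J1c-nu1.sig.lean` sha16 6bfe45ff777fe18d). Brick (ν1) = the three facts the patching engine (π) consumes:

* **(S1) sections ARE morphisms.** By the construction of the internal Hom `Modules.sheafHom` (`homPresheafAb`), the group
  `Γ(𝓗om(E, M), U)` is literally the Hom-group `E|_U ⟶ M|_U`, and restriction to `V ≤ U` is `restrictHom`; for the normal sheaf
  `normalSheaf ι = dual (conormalSheaf ι)` this is `normalSheaf_presheaf_map` (by `rfl`).
* **(S2) dual coordinates are a bijection.** In a frame `e : 𝒪^I ≅ E|_W`, a morphism `μ : E|_W ⟶ 𝒪|_W` is its tuple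
  `(dualCoord e μ j)_j = (μ(b_j))_j`: `dualCoord_injective` (`hom_ext_of_basisSection`), `dualCoord_homOfBasisValues` /
  `dualCoord_surjective` (`homOfBasisValues`), `dualCoord_bijective`, additivity `dualCoord_add/zero/neg/sub`.
* **(S3) restriction = restriction of coordinates.** `dualCoord_restrictHom_of_basisSection_eq` (any frame on the smaller open
  whose basis sections are the restricted ones), `dualCoord_restrictTrivialisation`; on the conormal sheaf, two frames built by
  `exists_conormalFrame_of_generators_of_isQuasiRegular` (p589925) on affines `V' ≤ V` from generators `x` and `x|_{V'}` have
  restricted basis sections (`conormal_basisSection_eq_map`, via injectivity of `𝓘 ↪ 𝒪` and `unitSectionLE_map`), hence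
  `dualCoord_restrictHom_conormal`.
* **(S1)+(S2) on the conormal frame**: `exists_normalSheaf_sections_coordinates` (the dealt signature verbatim) and the sharper
  `exists_normalSheaf_sections_dualCoord` (the additive bijection IS `dualCoord`, the ideal sections `s` as a function).

Everything is proved; DEF-FREE; no `sorry`; standard axioms. OURS; NOT a statement of any manuscript; AI-written, weaker than
expert review. `--supports stmt-ResolutionOfSingularities-20148 --as helper`. [cite: Hartshorne1977, II.5 and II Ex. 5.1] (index only).
-/

set_option linter.dupNamespace false -- mandated namespace `Summit.<Summit>.<Problem>` of this single-conjunct summit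

noncomputable section

open CategoryTheory CategoryTheory.Limits AlgebraicGeometry Opposite TopologicalSpace
open Literature.AlgebraicGeometry.Modules Literature.AlgebraicGeometry.Deformation Literature.AlgebraicGeometry.Motives
open Literature.AlgebraicGeometry.HodgeTheory Literature.AlgebraicGeometry.Resolution

namespace Summit.ResolutionOfSingularities.ResolutionOfSingularities.Cruxes.EquisingularLiftNat.Sections

universe u

/-! ### (S2) Dual coordinates in a frame: additivity and bijectivity -/

section Frames

variable {X : Scheme.{u}} {E : X.Modules} {W V : X.Opens} {I : Type u}
  (e : SheafOfModules.free I ≅ E.over W)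

/-- `dualCoord` is additive in `μ`. [folklore] -/
theorem dualCoord_add (μ μ' : E.over W ⟶ (unitModule X).over W) (j : I) :
    dualCoord e (μ + μ') j = dualCoord e μ j + dualCoord e μ' j := rfl

/-- `dualCoord` of the zero morphism vanishes. [folklore] -/
theorem dualCoord_zero (j : I) : dualCoord e (0 : E.over W ⟶ (unitModule X).over W) j = 0 := rfl

/-- `dualCoord` commutes with negation. [folklore] -/
theorem dualCoord_neg (μ : E.over W ⟶ (unitModule X).over W) (j : I) :
    dualCoord e (-μ) j = -dualCoord e μ j := by
  have h := dualCoord_add e (-μ) μ j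
  rw [neg_add_cancel, dualCoord_zero] at h
  exact eq_neg_of_add_eq_zero_left h.symm

/-- `dualCoord` commutes with subtraction. [folklore] -/
theorem dualCoord_sub (μ μ' : E.over W ⟶ (unitModule X).over W) (j : I) :
    dualCoord e (μ - μ') j = dualCoord e μ j - dualCoord e μ' j := by
  rw [sub_eq_add_neg, dualCoord_add, dualCoord_neg, sub_eq_add_neg]

/-- **A morphism out of a framed module is determined by its dual coordinates.** [folklore] -/
theorem dualCoord_injective :
    Function.Injective (fun μ : E.over W ⟶ (unitModule X).over W => fun j : I => dualCoord e μ j) :=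
  fun _ _ h => hom_ext_of_basisSection e fun j => congr_fun h j

/-- The dual coordinates of `homOfBasisValues e m` are the prescribed values `m`. [folklore] -/
theorem dualCoord_homOfBasisValues (m : I → Γ(X, W)) (j : I) :
    dualCoord e (homOfBasisValues e (M := unitModule X) m) j = m j :=
  appLE_homOfBasisValues e (M := unitModule X) m j

/-- **Every tuple of sections is the tuple of dual coordinates of a morphism.** [folklore] -/
theorem dualCoord_surjective :
    Function.Surjective (fun μ : E.over W ⟶ (unitModule X).over W => fun j : I => dualCoord e μ j) :=
  fun m => ⟨homOfBasisValues e (M := unitModule X) m, funext fun j => dualCoord_homOfBasisValues e m j⟩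

/-- **(S2) dual coordinates are a bijection**: a morphism `μ : E|_W ⟶ 𝒪|_W` out of a framed module is its tuple
`(dualCoord e μ j)_j = (μ(b_j))_j`. [folklore] -/
theorem dualCoord_bijective :
    Function.Bijective (fun μ : E.over W ⟶ (unitModule X).over W => fun j : I => dualCoord e μ j) :=
  ⟨dualCoord_injective e, dualCoord_surjective e⟩

/-! ### (S3) Restriction of dual coordinates -/

/-- **Restriction of dual coordinates**: if a frame `e'` of `E|_V`, `V ≤ W`, has as basis sections the restrictions of
those of `e`, the `e'`-coordinates of `μ|_V` are the restricted `e`-coordinates of `μ`. [folklore] -/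
theorem dualCoord_restrictHom_of_basisSection_eq (k : V ⟶ W) (e' : SheafOfModules.free I ≅ E.over V)
    (he' : ∀ j, basisSection e' j = E.presheaf.map k.op (basisSection e j))
    (μ : E.over W ⟶ (unitModule X).over W) (j : I) :
    dualCoord e' (restrictHom k μ) j = X.presheaf.map k.op (dualCoord e μ j) := by
  rw [dualCoord_def, dualCoord_def, he', appLE_restrictHom, Subsingleton.elim (𝟙 V ≫ k) (k ≫ 𝟙 W),
    appLE_map]
  rfl

/-- Restriction of dual coordinates to the restricted frame. [folklore] -/
theorem dualCoord_restrictTrivialisation (k : V ⟶ W) (μ : E.over W ⟶ (unitModule X).over W) (j : I) :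
    dualCoord (SheafOfModules.restrictTrivialisation (R := X.ringCatSheaf) k e) (restrictHom k μ) j =
      X.presheaf.map k.op (dualCoord e μ j) :=
  dualCoord_restrictHom_of_basisSection_eq e k _ (basisSection_restrictTrivialisation k e) μ j

/-! ### (S1) Sections of `𝓗om` and of the normal sheaf are morphisms; restriction is `restrictHom` -/

/-- **(S1) for `𝓗om(E, M)`**: the restriction map of the internal Hom on a section `φ : E|_U ⟶ M|_U` (a section over `U` by
construction of `sheafHom`) is `restrictHom`. [folklore] -/
theorem sheafHom_presheaf_map (E' M : X.Modules) {U U' : X.Opens} (k : U' ⟶ U) (φ : E'.over U ⟶ M.over U) :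
    (sheafHom E' M).presheaf.map k.op φ = restrictHom k φ := rfl

end Frames

section Normal

variable {X Z : Scheme.{u}} (ι : Z ⟶ X)

/-- **(S1) for the normal sheaf** `normalSheaf ι = 𝓗om(conormalSheaf ι, 𝒪_Z)`: a section over `U` is a morphism
`(conormalSheaf ι)|_U ⟶ 𝒪_Z|_U`, and restriction to `U' ≤ U` is `restrictHom`. [folklore] -/
theorem normalSheaf_presheaf_map {U U' : Z.Opens} (k : U' ⟶ U)
    (μ : (conormalSheaf ι).over U ⟶ (unitModule Z).over U) :
    (normalSheaf ι).presheaf.map k.op μ = restrictHom k μ := rfl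

/-- Sections of the normal sheaf add as morphisms do. [folklore] -/
theorem normalSheaf_sections_add {U : Z.Opens} (μ μ' : (conormalSheaf ι).over U ⟶ (unitModule Z).over U) :
    (μ + μ' : Γ(normalSheaf ι, U)) = ((μ + μ' : (conormalSheaf ι).over U ⟶ (unitModule Z).over U) : Γ(normalSheaf ι, U)) :=
  rfl

end Normal

/-! ### (S3) on the conormal sheaf: frames from generators on nested affines have restricted basis sections -/

section Conormal

variable {X Z : Scheme.{0}} (ι : Z ⟶ X)

/-- Ideal-module sections with restricted readings are restrictions (injectivity of `𝓘 ↪ 𝒪`). [folklore] -/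
theorem idealModule_section_eq_map_of_toRing_eq {V V' : X.Opens} (k : V' ≤ V) (s : Γ(idealModule ι, V))
    (s' : Γ(idealModule ι, V')) {a : Γ(X, V)} (hs : toRing (idealModuleι ι) V s = a)
    (hs' : toRing (idealModuleι ι) V' s' = X.presheaf.map (homOfLE k).op a) :
    s' = (idealModule ι).presheaf.map (homOfLE k).op s := by
  apply kernel_ι_app_injective (structureModuleMap ι) V'
  change toRing (idealModuleι ι) V' s' = toRing (idealModuleι ι) V' ((idealModule ι).presheaf.map (homOfLE k).op s)
  rw [hs', ← map_toRing, hs]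

/-- `η` (over the preimage) of a restricted ideal section is the restricted `η`. [folklore] -/
theorem unitSectionLE_refl_map {V V' : X.Opens} (k : V' ≤ V) (s : Γ(idealModule ι, V)) :
    unitSectionLE ι (idealModule ι) (le_refl (ι ⁻¹ᵁ V')) ((idealModule ι).presheaf.map (homOfLE k).op s) =
      (conormalSheaf ι).presheaf.map (homOfLE (ι.preimage_mono k)).op
        (unitSectionLE ι (idealModule ι) (le_refl (ι ⁻¹ᵁ V)) s) := by
  rw [unitSectionLE, unitSectionLE, unitSection_map, presheaf_map_map]
  change _ = ((Scheme.Modules.pullback ι).obj (idealModule ι)).presheaf.map (homOfLE (ι.preimage_mono k)).op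
    (((Scheme.Modules.pullback ι).obj (idealModule ι)).presheaf.map (homOfLE (le_refl (ι ⁻¹ᵁ V))).op
      (unitSection ι (idealModule ι) V s))
  rw [presheaf_map_map]
  rfl

/-- **(S3), conormal basis sections restrict**: two conormal frames on `ι⁻¹V' ⊆ ι⁻¹V` whose basis sections are `η(s_j)`,
`η(s'_j)` for ideal sections reading to generators `x_j` and `x_j|_{V'}` (the output shape of
`exists_conormalFrame_of_generators_of_isQuasiRegular`) have `b'_j = b_j|_{ι⁻¹V'}`. [folklore] -/
theorem conormal_basisSection_eq_map {V V' : X.Opens} (k : V' ≤ V) {n : ℕ} (x : Fin n → Γ(X, V))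
    (s : Fin n → Γ(idealModule ι, V)) (s' : Fin n → Γ(idealModule ι, V'))
    (hs : ∀ j, toRing (idealModuleι ι) V (s j) = x j)
    (hs' : ∀ j, toRing (idealModuleι ι) V' (s' j) = X.presheaf.map (homOfLE k).op (x j))
    (e : SheafOfModules.free (Fin n) ≅ (conormalSheaf ι).over (ι ⁻¹ᵁ V))
    (e' : SheafOfModules.free (Fin n) ≅ (conormalSheaf ι).over (ι ⁻¹ᵁ V'))
    (he : ∀ j, basisSection e j = unitSectionLE ι (idealModule ι) (le_refl _) (s j))
    (he' : ∀ j, basisSection e' j = unitSectionLE ι (idealModule ι) (le_refl _) (s' j)) (j : Fin n) :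
    basisSection e' j = (conormalSheaf ι).presheaf.map (homOfLE (ι.preimage_mono k)).op (basisSection e j) := by
  rw [he', he, idealModule_section_eq_map_of_toRing_eq ι k (s j) (s' j) (hs j) (hs' j)]
  exact unitSectionLE_refl_map ι k (s j)

/-- **(S3), coordinates of normal-sheaf sections restrict**: with frames as in `conormal_basisSection_eq_map`, the
`e'`-coordinates of `μ|_{ι⁻¹V'}` are the restrictions of the `e`-coordinates of `μ`. [folklore] -/
theorem dualCoord_restrictHom_conormal {V V' : X.Opens} (k : V' ≤ V) {n : ℕ} (x : Fin n → Γ(X, V))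
    (s : Fin n → Γ(idealModule ι, V)) (s' : Fin n → Γ(idealModule ι, V'))
    (hs : ∀ j, toRing (idealModuleι ι) V (s j) = x j)
    (hs' : ∀ j, toRing (idealModuleι ι) V' (s' j) = X.presheaf.map (homOfLE k).op (x j))
    (e : SheafOfModules.free (Fin n) ≅ (conormalSheaf ι).over (ι ⁻¹ᵁ V))
    (e' : SheafOfModules.free (Fin n) ≅ (conormalSheaf ι).over (ι ⁻¹ᵁ V'))
    (he : ∀ j, basisSection e j = unitSectionLE ι (idealModule ι) (le_refl _) (s j))
    (he' : ∀ j, basisSection e' j = unitSectionLE ι (idealModule ι) (le_refl _) (s' j))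
    (μ : (conormalSheaf ι).over (ι ⁻¹ᵁ V) ⟶ (unitModule Z).over (ι ⁻¹ᵁ V)) (j : Fin n) :
    dualCoord e' (restrictHom (homOfLE (ι.preimage_mono k)) μ) j =
      Z.presheaf.map (homOfLE (ι.preimage_mono k)).op (dualCoord e μ j) :=
  dualCoord_restrictHom_of_basisSection_eq e (homOfLE (ι.preimage_mono k)) e'
    (conormal_basisSection_eq_map ι k x s s' hs hs' e e' he he') μ j

/-! ### (S1)+(S2) on the conormal frame of a quasi-regular generating sequence -/

variable [IsClosedImmersion ι] [IsLocallyNoetherian X]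

/-- **(ν1) — sections of the normal sheaf on a frame chart are value tuples, by `dualCoord`.** On `ι⁻¹V`, `V` affine with
quasi-regular generators `x` of the ideal of `ι`, there are ideal sections `s_j ↦ x_j`, a conormal frame `e` with basis sections
`η(s_j)`, and an additive bijection `Γ(𝒩, ι⁻¹V) ≃+ Γ(𝒪_Z, ι⁻¹V)ⁿ` which IS `μ ↦ (dualCoord e μ j)_j = (μ(η(s_j)))_j`.
[OURS · L1 W4.5b · EL♮(3) · J1c (ν1)] -/
theorem exists_normalSheaf_sections_dualCoord (V : X.affineOpens) {n : ℕ} (x : Fin n → Γ(X, (V : X.Opens)))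
    (hqr : IsQuasiRegular x) (hI : Ideal.span (Set.range x) = ι.ker.ideal V) :
    ∃ (s : Fin n → Γ(idealModule ι, (V : X.Opens)))
      (e : SheafOfModules.free (Fin n) ≅ (conormalSheaf ι).over (ι ⁻¹ᵁ (V : X.Opens)))
      (Φ : Γ(normalSheaf ι, ι ⁻¹ᵁ (V : X.Opens)) ≃+ (Fin n → Γ(unitModule Z, ι ⁻¹ᵁ (V : X.Opens)))),
      (∀ j, toRing (idealModuleι ι) (V : X.Opens) (s j) = x j) ∧
      (∀ j, basisSection e j = unitSectionLE ι (idealModule ι) (le_refl _) (s j)) ∧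
      ∀ (μ : (conormalSheaf ι).over (ι ⁻¹ᵁ (V : X.Opens)) ⟶ (unitModule Z).over (ι ⁻¹ᵁ (V : X.Opens))) (j : Fin n),
        Φ μ j = dualCoord e μ j := by
  obtain ⟨s, e, hs, he⟩ := exists_conormalFrame_of_generators_of_isQuasiRegular ι V x hqr hI
  let f : Γ(normalSheaf ι, ι ⁻¹ᵁ (V : X.Opens)) →+ (Fin n → Γ(unitModule Z, ι ⁻¹ᵁ (V : X.Opens))) :=
    { toFun := fun μ j => dualCoord e μ j
      map_zero' := funext fun j => dualCoord_zero e j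
      map_add' := fun μ μ' => funext fun j => dualCoord_add e μ μ' j }
  exact ⟨s, e, AddEquiv.ofBijective f (dualCoord_bijective e), hs, he, fun μ j => rfl⟩

/-- **(S1)+(S2) on the conormal frame — the dealt signature** (`L/res-type-027/J1c-nu1.sig.lean`,
`exists_normalSheaf_sections_coordinates_sig`): on `ι⁻¹V`, `V` affine with quasi-regular generators `x` of the ideal,
sections of the normal sheaf are tuples in `Γ(Z, ι⁻¹V)ⁿ` by an additive bijection, for a conormal frame whose basis sections are
the classes of the `x_j` (the binder is spelled `_Φ` because, as dealt, the body does not mention it; the sharp form tying `Φ` to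
`dualCoord e` is `exists_normalSheaf_sections_dualCoord`). [OURS · L1 W4.5b · EL♮(3) · J1c (ν1)] -/
theorem exists_normalSheaf_sections_coordinates (V : X.affineOpens) {n : ℕ} (x : Fin n → Γ(X, (V : X.Opens)))
    (hqr : IsQuasiRegular x) (hI : Ideal.span (Set.range x) = ι.ker.ideal V) :
    ∃ (e : SheafOfModules.free (Fin n) ≅ (conormalSheaf ι).over (ι ⁻¹ᵁ (V : X.Opens)))
      (_Φ : Γ(normalSheaf ι, ι ⁻¹ᵁ (V : X.Opens)) ≃+ (Fin n → Γ(unitModule Z, ι ⁻¹ᵁ (V : X.Opens)))),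
      (∀ j, ∃ s : Γ(idealModule ι, (V : X.Opens)), toRing (idealModuleι ι) (V : X.Opens) s = x j ∧
        basisSection e j = unitSectionLE ι (idealModule ι) (le_refl _) s) := by
  obtain ⟨s, e, Φ, hs, he, -⟩ := exists_normalSheaf_sections_dualCoord ι V x hqr hI
  exact ⟨e, Φ, fun j => ⟨s j, hs j, he j⟩⟩

end Conormal

end Summit.ResolutionOfSingularities.ResolutionOfSingularities.Cruxes.EquisingularLiftNat.Sections

end
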